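/-
HONEST FRAMING: certified error envelopes and provably optimal rounding/accumulation schemes for
low-precision formats under stated cost models; every table by two implementations; no hardware
or vendor claims.
-/
import Summits.Ventures.CertifiedArithmetic.LowPrec.OptDemotionRouting

/-!
# The demotion law (Theorem T8), part 8a′: weights and the routing value of ONE bit

For the weighted routing value `treeBRw` of part 8a: a WEIGHT is a nonnegative `W : ℤ → ℚ` with
`W (e - q) = u · W e` (the bit injected by `e` weighs `u` times `e`; the actual weight `2^e` has
`u = 2^-q`, `isWeight_zpow`).  The routing count of a single bit is opt's `A_t`
(`treeA u t`: `A_leaf = 0`, `A_(a·b) = 1 + max (A_a + u A_b) (A_b + u A_a)`), with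
`1 + u · A_t = M_t` (`one_add_mul_treeA`, the tree polynomial of Theorem U), and
`treeBRw q W t {e} = W e · A_t` (`treeBRw_singleton`), i.e. `u · treeBRw q W t {e} = W e · (M_t - 1)`.
-/

namespace Summit.Ventures.CertifiedArithmetic.LowPrec.Opt

open Literature.ComputerArithmetic.JeannerodRump2018
open Literature.ComputerArithmetic.JeannerodRump2018.SumTree

/-! ## The value of one bit: `A_t` with `1 + u·A_t = M_t` -/

/-- The routing count of a single bit: `A_leaf = 0`, `A_(a·b) = 1 + max (A_a + u A_b) (A_b + u A_a)`
(the bit goes to one child, its injected half ulp to the other). -/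
def treeA (u : ℚ) : SumTree → ℚ
  | .leaf _ => 0
  | .node a b => 1 + max (treeA u a + u * treeA u b) (treeA u b + u * treeA u a)

/-- `A_leaf = 0`. -/
@[simp] theorem treeA_leaf (u x : ℚ) : treeA u (.leaf x) = 0 := rfl

/-- The node rule of `A`. -/
theorem treeA_node (u : ℚ) (a b : SumTree) :
    treeA u (.node a b) = 1 + max (treeA u a + u * treeA u b) (treeA u b + u * treeA u a) := rfl

/-- `A_t ≥ 0`. -/
theorem treeA_nonneg {u : ℚ} (hu : 0 ≤ u) : ∀ t : SumTree, 0 ≤ treeA u t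
  | .leaf _ => le_rfl
  | .node a b => by
      rw [treeA_node]
      have ha := treeA_nonneg hu a
      have hb := treeA_nonneg hu b
      have : 0 ≤ treeA u a + u * treeA u b := add_nonneg ha (mul_nonneg hu hb)
      exact add_nonneg zero_le_one (this.trans (le_max_left _ _))

/-- `1 + u · A_t = M_t` (`0 ≤ u ≤ 1`): the tree polynomial counts the routing of one bit. -/
theorem one_add_mul_treeA {u : ℚ} (hu0 : 0 ≤ u) (hu1 : u ≤ 1) :
    ∀ t : SumTree, 1 + u * treeA u t = treeM u t
  | .leaf _ => by simp
  | .node a b => by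
      rw [treeA_node, treeM_node, ← one_add_mul_treeA hu0 hu1 a, ← one_add_mul_treeA hu0 hu1 b]
      have ha := treeA_nonneg hu0 a
      have hb := treeA_nonneg hu0 b
      rcases le_total (treeA u a) (treeA u b) with h | h
      · have h1 : treeA u a + u * treeA u b ≤ treeA u b + u * treeA u a := by
          nlinarith [mul_nonneg (sub_nonneg.2 hu1) (sub_nonneg.2 h)]
        have h2 : 1 + u * treeA u a ≤ 1 + u * treeA u b := by nlinarith [mul_le_mul_of_nonneg_left h hu0]
        rw [max_eq_right h1, max_eq_right h2, min_eq_left h2]; ring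
      · have h1 : treeA u b + u * treeA u a ≤ treeA u a + u * treeA u b := by
          nlinarith [mul_nonneg (sub_nonneg.2 hu1) (sub_nonneg.2 h)]
        have h2 : 1 + u * treeA u b ≤ 1 + u * treeA u a := by nlinarith [mul_le_mul_of_nonneg_left h hu0]
        rw [max_eq_left h1, max_eq_left h2, min_eq_right h2]; ring

/-- WEIGHTS: nonnegative, and the bit injected by `e` (exponent `e - q`) weighs `u` times `e`. -/
structure IsWeight (q : ℕ) (u : ℚ) (W : ℤ → ℚ) : Prop where
  /-- nonnegativity -/
  nonneg : ∀ e, 0 ≤ W e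
  /-- the injected half ulp -/
  shift : ∀ e, W (e - q) = u * W e

/-- The actual weight `2^e` is a weight for `u = 2^-q = unitRoundoff q`. -/
theorem isWeight_zpow (q : ℕ) : IsWeight q (unitRoundoff q) fun e => (2 : ℚ) ^ e :=
  ⟨fun e => (zpow_pos (by norm_num) e).le, fun e => by
    simp only [unitRoundoff, one_div]
    rw [zpow_sub₀ (by norm_num), zpow_natCast, div_eq_mul_inv, mul_comm]⟩

/-- The configurations inside `{e - q, e}` that are routable: `∅`, `{e}`, `{e - q}`. -/
theorem subset_pair_cases {q : ℕ} {e : ℤ} {A : Finset ℤ} (hA : A ⊆ insert (e - q) {e})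
    (hr : Routable q A) : A = ∅ ∨ A = {e} ∨ A = {e - (q : ℤ)} := by
  by_cases h1 : e - q ∈ A
  · by_cases h2 : e ∈ A
    · exact (not_routable_of_mem_mem hr h2 h1).elim
    · right; right
      ext x
      simp only [Finset.mem_singleton]
      constructor
      · intro hx
        have := hA hx
        simp only [Finset.mem_insert, Finset.mem_singleton] at this
        rcases this with rfl | rfl
        · rfl
        · exact absurd hx h2
      · rintro rfl; exact h1
  · have hA' : A ⊆ {e} := fun x hx => by
      have := hA hx
      simp only [Finset.mem_insert, Finset.mem_singleton] at this
      rcases this with rfl | h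
      · exact absurd hx h1
      · exact Finset.mem_singleton.2 h
    rcases Finset.subset_singleton_iff.1 hA' with h | h
    · exact Or.inl h
    · exact Or.inr (Or.inl h)

/-- THE VALUE OF ONE BIT: `treeBRw q W t {e} = W e · A_t`. -/
theorem treeBRw_singleton {q : ℕ} {u : ℚ} {W : ℤ → ℚ} (hq : 1 ≤ q) (hu0 : 0 ≤ u) (hu1 : u ≤ 1)
    (hW : IsWeight q u W) : ∀ (t : SumTree) (e : ℤ), treeBRw q W t {e} = W e * treeA u t
  | .leaf _, e => by simp
  | .node a b, e => by
      have hne : ({e} : Finset ℤ).Nonempty := Finset.singleton_nonempty e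
      have htop : ({e} : Finset ℤ).max' hne = e := Finset.max'_singleton e
      have ha := treeBRw_singleton hq hu0 hu1 hW a
      have hb := treeBRw_singleton hq hu0 hu1 hW b
      have hAa := treeA_nonneg hu0 a
      have hAb := treeA_nonneg hu0 b
      have hWe := hW.nonneg e
      have hq1 : (1 : ℤ) ≤ q := by exact_mod_cast hq
      set R := max (treeA u a + u * treeA u b) (treeA u b + u * treeA u a) with hR
      have hR0 : 0 ≤ R := (add_nonneg hAa (mul_nonneg hu0 hAb)).trans (le_max_left _ _)
      -- the value of a part of a split of {e}
      have hval : ∀ (c : SumTree) (A : Finset ℤ), (∀ e', treeBRw q W c {e'} = W e' * treeA u c) →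
          A ⊆ insert (e - q) {e} → Routable q A →
          (A = ∅ ∧ treeBRw q W c A = 0) ∨ (A = {e} ∧ treeBRw q W c A = W e * treeA u c) ∨
            (A = {e - (q : ℤ)} ∧ treeBRw q W c A = u * (W e * treeA u c)) := by
        intro c A hc hA hr
        rcases subset_pair_cases hA hr with rfl | rfl | rfl
        · exact Or.inl ⟨rfl, treeBRw_empty q W c⟩
        · exact Or.inr (Or.inl ⟨rfl, hc e⟩)
        · right; right; exact ⟨rfl, by rw [hc, hW.shift, mul_assoc]⟩
      refine le_antisymm ?_ ?_
      · -- every valid split scores ≤ W e · R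
        have h := treeBRw_node_le (q := q) (W := W) (a := a) (b := b) hne (c := W e * R)
          (mul_nonneg hWe hR0) ?_
        · rw [htop] at h
          calc treeBRw q W (.node a b) {e} ≤ W e + W e * R := h
            _ = W e * treeA u (.node a b) := by rw [treeA_node, hR]; ring
        · intro AB hAB
          rw [htop] at hAB
          obtain ⟨hA, hB, hdisj, -, hrA, hrB⟩ := of_mem_splits (A := AB.1) (B := AB.2) hAB
          have hRa : treeA u a + u * treeA u b ≤ R := le_max_left _ _
          have hRb : treeA u b + u * treeA u a ≤ R := le_max_right _ _
          rcases hval a AB.1 ha hA hrA with ⟨hA1, hvA⟩ | ⟨hA1, hvA⟩ | ⟨hA1, hvA⟩ <;>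
            rcases hval b AB.2 hb hB hrB with ⟨hB1, hvB⟩ | ⟨hB1, hvB⟩ | ⟨hB1, hvB⟩ <;>
            rw [hvA, hvB]
          · nlinarith
          · nlinarith [mul_nonneg hu0 hAa, mul_nonneg hWe (mul_nonneg hu0 hAa)]
          · nlinarith [mul_nonneg hWe hAb, mul_nonneg (sub_nonneg.2 hu1) (mul_nonneg hWe hAb),
              mul_nonneg hWe (mul_nonneg hu0 hAa)]
          · nlinarith [mul_nonneg hWe (mul_nonneg hu0 hAb)]
          · -- ({e}, {e}) is not disjoint
            exfalso
            rw [hA1, hB1] at hdisj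
            exact Finset.disjoint_singleton.1 hdisj rfl
          · nlinarith
          · nlinarith [mul_nonneg hWe hAb, mul_nonneg (sub_nonneg.2 hu1) (mul_nonneg hWe hAa),
              mul_nonneg hWe (mul_nonneg hu0 hAb), mul_nonneg hWe hAa]
          · nlinarith
          · -- ({e-q}, {e-q}) is not disjoint
            exfalso
            rw [hA1, hB1] at hdisj
            exact Finset.disjoint_singleton.1 hdisj rfl
      · -- the two injected splits realise W e · R
        have hι : e - (q : ℤ) ≠ e := by linarith
        have hsd1 : insert (e - (q : ℤ)) ({e} : Finset ℤ) \ {e} = {e - (q : ℤ)} := by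
          ext x
          simp only [Finset.mem_sdiff, Finset.mem_insert, Finset.mem_singleton]
          constructor
          · rintro ⟨h | h, h'⟩
            · exact h
            · exact absurd h h'
          · rintro rfl; exact ⟨Or.inl rfl, hι⟩
        have hsd2 : insert (e - (q : ℤ)) ({e} : Finset ℤ) \ {e - (q : ℤ)} = {e} := by
          ext x
          simp only [Finset.mem_sdiff, Finset.mem_insert, Finset.mem_singleton]
          constructor
          · rintro ⟨h | h, h'⟩
            · exact absurd h h'
            · exact h
          · rintro rfl; exact ⟨Or.inr rfl, hι.symm⟩
        have hm1 : (({e} : Finset ℤ), ({e - (q : ℤ)} : Finset ℤ)) ∈ splits q {e} e := by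
          refine mem_splits.2 ⟨Or.inr ⟨?_, ?_⟩, routable_singleton hq _, routable_singleton hq _⟩
          · exact Finset.subset_insert _ _
          · exact hsd1.symm
        have hm2 : (({e - (q : ℤ)} : Finset ℤ), ({e} : Finset ℤ)) ∈ splits q {e} e := by
          refine mem_splits.2 ⟨Or.inr ⟨?_, ?_⟩, routable_singleton hq _, routable_singleton hq _⟩
          · exact Finset.singleton_subset_iff.2 (Finset.mem_insert_self _ _)
          · exact hsd2.symm
        have h1 := split_le_treeBRw_node (q := q) (W := W) (a := a) (b := b) hne (htop ▸ hm1)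
        have h2 := split_le_treeBRw_node (q := q) (W := W) (a := a) (b := b) hne (htop ▸ hm2)
        rw [htop, ha, hb, hW.shift] at h1 h2
        rw [treeA_node]
        rcases le_total (treeA u a + u * treeA u b) (treeA u b + u * treeA u a) with h | h
        · rw [max_eq_right h]; nlinarith
        · rw [max_eq_left h]; nlinarith

/-- In particular `u · treeBRw q W t {e} = W e · (M_t - 1)`. -/
theorem mul_treeBRw_singleton {q : ℕ} {u : ℚ} {W : ℤ → ℚ} (hq : 1 ≤ q) (hu0 : 0 ≤ u) (hu1 : u ≤ 1)
    (hW : IsWeight q u W) (t : SumTree) (e : ℤ) :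
    u * treeBRw q W t {e} = W e * (treeM u t - 1) := by
  rw [treeBRw_singleton hq hu0 hu1 hW, ← one_add_mul_treeA hu0 hu1]; ring

end Summit.Ventures.CertifiedArithmetic.LowPrec.Opt
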